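import Literature.MathematicalPhysics.QuantumFieldTheory.Balaban1983to89.B13InverseLettersNeumann

/-!
# `Balaban1983to89.B13InverseLettersNeumannOneLoss` — T. Bałaban, *Propagators for lattice gauge theories in a background field*,
Commun. Math. Phys. **99** (1985) 389–434 [Balaban1985BackgroundPropagators], Sect. B (3.60)–(3.65) p. 402, p. 403 ll. 3–5 («… we can prove
all the statements (3.42)–(3.47) of Theorem 3.1 for the operator G′(U′U), of course with different constants»), (3.86) p. 407, Thm 3.10
(3.107)–(3.108) p. 416; T. Bałaban, *Propagators and renormalization transformations for lattice gauge theories. II*, Commun. Math. Phys.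
**96** (1984) 223–250 [Balaban1984PropagatorsII], (2.52)–(2.55) p. 232 («this property is preserved under the composition of operators
possessing it»), Lemma 2.1 (2.61) p. 234; *Renormalization group approach to lattice gauge field theories. II*, Commun. Math. Phys. **116**
(1988) 1–22 [Balaban1988RG2Cluster] p. 13, p. 15, (2.16) p. 16: **SECT. B's NEUMANN ROAD WITH THE RATE LOST ONCE** — module 58
(`B13InverseLettersNeumann.rawEntryLetters_inv_of_neumann`) concludes `RawEntryLetters (u ↦ A(u)⁻¹) loc R₁ (ρ − 3μ) (2B_G)` under `3μ ≤ ρ`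
(the rate is lost thrice: deviation × `G₀`, powers, `G₀` × powers); THIS FILE proves the SAME conclusion at rate `ρ − μ` under `2μ ≤ ρ`
with the SAME smallness `(2B·R₁∕R)·B_G·(mC)² ≤ ½`, by the random-walk bookkeeping of [4] (2.55) applied to the whole word
`G₀(VG₀)ⁿ = (((G₀·V)·G₀)·V)·G₀ ⋯` — every multiplication has a FULL-rate factor on the right, so the target rate `ρ − μ` is kept through
the word (module 34 `rawEntryLetters_mul` with `κ := ρ − μ ≤ ρ₁`, `κ + μ = ρ ≤ ρ₂`).

statement-level bookkeeping ([folklore] Neumann series + [4]'s composition rule) over the landed modules 34 ∕ 56A ∕ 58 and pv27's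
`B9Eq386Neumann`, with citation tags; kernel-checked; nothing here is a claim about the Yang–Mills mass gap; nothing of Bałaban's
operators is constructed or asserted; no node is discharged; count-neutral.

WHY THIS FILE (cell `pub-ymgap`, HUMAN RULING D-0062 Track A ∕ D-0149 width seats, node N10 = [B13]; seat `pub-ymgap-dag-n10-w3` g2; the
lane owner's trigger (t-rates) in `HOME/pub-ymgap-dag-n10-c/HANDOFF.md` §g12 «a smaller rate loss ⇒ 58 v1.1 … a two-loss version needs a
chain lemma `G₀(VG₀)ⁿ` with one junction rate»).  The N10 junction of record (module 67) spends the fluctuation operator's decay rate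
`ρΔ` on a RATE BUDGET `ηΔ + εP + kapP + 4μΔ ≤ ρΔ` (`B13EntrywiseBlockNumerals.rates_of_budget`); every inverse factor of the operator
entering `hEL` by the Neumann road arrives with the rate module 58 leaves it, so two junction losses saved per inverse factor are two
losses more for the budget.  Print is indifferent («of course with different constants»); the tree's budget is not.
* §1 ★ `rawEntryLetters_G_mul_pow` — the word `u ↦ G₀·((A 0 − A u)·G₀)ⁿ` has letters `(R₁, ρ − μ, B_G·θⁿ)`,
  `θ := (2B·R₁∕R)·B_G·(mC)·(mC)`, for EVERY `0 ≤ μ ≤ ρ` (induction on the word; [4] (2.55)).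
* §2 ★★★ `rawEntryLetters_inv_of_neumann_oneLoss` — module 58 §3's theorem with `h3μ : 3μ ≤ ρ` REPLACED by `h2μ : 2μ ≤ ρ` and the
  conclusion's rate `ρ − 3μ` by `ρ − μ`; everything else (inputs, smallness, constant `2B_G`) VERBATIM; `…_oneLoss_torus` (row sum
  discharged, `C = c₀(1,μ)^ν`).
* §3 A2 ∕ A6: `rawEntryLetters_inv_of_neumann_oneLoss_toy` — 58 §4's toy family `(γ+u)·1` reaches rate `4μ − μ = 3μ` (58: `μ`) at the
  same located radius.
HONEST FRAMING: generic kernel bookkeeping; Theorem 3.10 at the centre and the complexification of Bałaban's operators stay displayed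
hypotheses of their owners (N06 ∕ NODE 00); nothing of Bałaban's is constructed or asserted; N10 NOT discharged; count-neutral; 0 `def`,
0 `sorry`; standard axioms; one finite 𝕋⁴ programme at fixed ε — nothing continuum ∕ OS ∕ mass gap ∕ Clay.
-/

noncomputable section

namespace Literature.MathematicalPhysics.QuantumFieldTheory.Balaban1983to89.B13InverseLettersNeumannOneLoss

open Metric Set Finset
open scoped Matrix
open Literature.MathematicalPhysics.QuantumFieldTheory.Balaban1983to89
open Literature.MathematicalPhysics.QuantumFieldTheory.Balaban1983to89.B9Thm37GlueTorus (tdist1 tdist1_nonneg tdist1_comm tdist1_self)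
open Literature.MathematicalPhysics.QuantumFieldTheory.Balaban1983to89.B5TorusCover (UT)
open Literature.MathematicalPhysics.QuantumFieldTheory.Balaban1983to89.B13EntrywiseWalks (RawEntryLetters)
open Literature.MathematicalPhysics.QuantumFieldTheory.Balaban1983to89.B13Sqrt27Accretive (differentiableOn_inv_apply)
open Literature.MathematicalPhysics.QuantumFieldTheory.Balaban1983to89.B13EntryLetterAlgebra
  (rawEntryLetters_const rawEntryLetters_mul rawEntryLetters_mono rawEntryLetters_congr)
open Literature.MathematicalPhysics.QuantumFieldTheory.Balaban1983to89.B13LocalKernelWalks (rowSum_torus)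
open Literature.MathematicalPhysics.QuantumFieldTheory.Balaban1983to89.B13AccretiveOfRealCoercive (rowSum_decay_le)
open Literature.MathematicalPhysics.QuantumFieldTheory.Balaban1983to89.B13RealSliceEntryLetters (toyFamily)
open Literature.MathematicalPhysics.QuantumFieldTheory.Balaban1983to89.B13InverseLettersNeumann
  (linfty_opNorm_le_of_rowSum hasSum_apply_of_hasSum rawEntryLetters_zero_sub rawEntryLetters_toyFamily toy_rightInverse toy_G₀_letters)
open Literature.MathematicalPhysics.QuantumFieldTheory.Balaban1983to89.B9Eq386Neumann (gNew sub_mul_gNew hasSum_gNew)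

variable {ν : ℕ} {Nf : Fin ν → ℕ} [∀ i, NeZero (Nf i)]
variable {E : Type*} [NormedAddCommGroup E] [NormedSpace ℂ E]
variable {p : Type} [Fintype p] [DecidableEq p]

/-! ## §1. The word `G₀·(V·G₀)ⁿ` keeps the rate `ρ − μ` ([4] (2.55): one loss for the whole word) -/

section Word

variable {A : E → Matrix p p ℂ} {loc : p → UT Nf} {R R₁ ρ μ B BG C : ℝ} {m : ℕ} {G₀ : Matrix p p ℂ}

/-- ★ **THE NEUMANN WORD LOSES THE RATE ONCE.**  From the letters `(R, ρ, B)` of `A`, a `u`-constant `G₀` with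
`‖G₀ i j‖ ≤ B_G e^{−ρd}`, a fibre bound `m`, a row sum `C` at a rate `0 ≤ μ ≤ ρ` and the thin radius `0 ≤ R₁ ≤ R`: for every `n` the word
`u ↦ G₀·((A 0 − A u)·G₀)ⁿ` has letters `(R₁, ρ − μ, B_G·θⁿ)` with `θ := (2B·R₁∕R)·B_G·(mC)·(mC)` — each step `X ↦ (X·V)·G₀` multiplies a
rate-`(ρ−μ)` family on the right by FULL-rate factors (`rawEntryLetters_mul` with `κ := ρ − μ`, `κ + μ ≤ ρ`), so no further rate is spent.
[cite: Balaban1984PropagatorsII, (2.52)–(2.55) p.232, Lemma 2.1 (2.61) p.234; Balaban1985BackgroundPropagators, (3.86) p.407, (3.108) p.416] -/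
theorem rawEntryLetters_G_mul_pow (hA : RawEntryLetters A loc R ρ B)
    (hG : ∀ i j, ‖G₀ i j‖ ≤ BG * Real.exp (-(ρ * tdist1 Nf (loc i) (loc j)))) (hBG : 0 ≤ BG)
    (hfib : ∀ y : UT Nf, (univ.filter fun k => loc k = y).card ≤ m)
    (hμ : 0 ≤ μ) (hμρ : μ ≤ ρ) (hC : 0 ≤ C)
    (hrow : ∀ a : UT Nf, ∑ z : UT Nf, Real.exp (-(μ * tdist1 Nf a z)) ≤ C)
    (hR₁ : 0 ≤ R₁) (hR₁R : R₁ ≤ R) (n : ℕ) :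
    RawEntryLetters (fun u => G₀ * ((A 0 - A u) * G₀) ^ n) loc R₁ (ρ - μ)
      (BG * (2 * B * R₁ / R * BG * (m * C) * (m * C)) ^ n) := by
  -- the full-rate pieces on the thin ball: the deviation `V(u) = A(0) − A(u)` and the centre's inverse `G₀`
  have hV : RawEntryLetters (fun u => A 0 - A u) loc R₁ ρ (2 * B * R₁ / R) := rawEntryLetters_zero_sub hA hR₁ hR₁R
  have hG0 : RawEntryLetters (fun _ : E => G₀) loc R₁ ρ BG := rawEntryLetters_const loc R₁ hBG hG
  induction n with
  | zero =>
      refine rawEntryLetters_mono (rawEntryLetters_congr hG0 fun u _ => ?_) le_rfl (by linarith) (le_of_eq (by ring))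
      rw [pow_zero, Matrix.mul_one]
  | succ n ih =>
      -- `(G₀·(VG₀)ⁿ)·V` at rate `ρ − μ` (right factor at full rate), then `·G₀` likewise
      have h1 : RawEntryLetters (fun u => G₀ * ((A 0 - A u) * G₀) ^ n * (A 0 - A u)) loc R₁ (ρ - μ)
          (BG * (2 * B * R₁ / R * BG * (m * C) * (m * C)) ^ n * (2 * B * R₁ / R) * (m * C)) :=
        rawEntryLetters_mul ih hV (κ := ρ - μ) (μ := μ) (by linarith) le_rfl (by linarith) hC hfib hrow
      have h2 : RawEntryLetters (fun u => G₀ * ((A 0 - A u) * G₀) ^ n * (A 0 - A u) * G₀) loc R₁ (ρ - μ)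
          (BG * (2 * B * R₁ / R * BG * (m * C) * (m * C)) ^ n * (2 * B * R₁ / R) * (m * C) * BG * (m * C)) :=
        rawEntryLetters_mul h1 hG0 (κ := ρ - μ) (μ := μ) (by linarith) le_rfl (by linarith) hC hfib hrow
      refine rawEntryLetters_mono (rawEntryLetters_congr h2 fun u _ => ?_) le_rfl le_rfl (le_of_eq (by ring))
      rw [pow_succ, ← Matrix.mul_assoc, ← Matrix.mul_assoc]

end Word

/-! ## §2. ★★★ The (3.108)-letters of the inverse family on the thin ball, rate lost ONCE -/

section Neumann

open scoped Matrix.Norms.Operator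

variable {A : E → Matrix p p ℂ} {loc : p → UT Nf} {R R₁ ρ μ B BG C : ℝ} {m : ℕ} {G₀ : Matrix p p ℂ}

/-- ★★★ **SECT. B's ROAD WITH ONE RATE LOSS.**  Module 58 §3's inputs VERBATIM — (i) `RawEntryLetters A loc R ρ B` (the complexified
operator on the chart ball, [II] p. 15 — displayed by its owner); (ii) ONE right inverse `G₀` of `A(0)` with `‖G₀ i j‖ ≤ B_G e^{−ρ d(loc i, loc j)}`
(Theorem 3.10 at the centre — N06's content); (iii) a fibre bound `m` and a row sum `C` at a rate `μ ≥ 0`; (iv) the thin radius `0 < R₁ ≤ R`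
with the smallness `(2B·R₁∕R)·B_G·(mC)² ≤ ½` — EXCEPT that `3μ ≤ ρ` is weakened to `2μ ≤ ρ`; conclusion `RawEntryLetters (u ↦ A(u)⁻¹) loc R₁ (ρ − μ) (2B_G)`
(58: rate `ρ − 3μ`).  Proof = 58's with §1's word letters: sup-row-sum norm of `V(u)G₀` `≤ θ ≤ ½` (its letters at rate `ρ − μ ≥ μ`),
`A(u)⁻¹ = G₀·Σₙ(V(u)G₀)ⁿ` (`B9Eq386Neumann.sub_mul_gNew`, `Matrix.inv_eq_right_inv`), entrywise resummation `B_G·Σθⁿ ≤ 2B_G` at rate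
`ρ − μ` (`HasSum.norm_le_of_bounded`), holomorphy by Cramer.
[cite: Balaban1985BackgroundPropagators, (3.60)-(3.65) p.402, p.403 ll.3-5, (3.86) p.407, Thm 3.10 (3.107)-(3.108) p.416;
Balaban1984PropagatorsII, (2.52)-(2.55) p.232, Lemma 2.1 (2.61) p.234; Balaban1988RG2Cluster, p.13, p.15, (2.16) p.16] -/
theorem rawEntryLetters_inv_of_neumann_oneLoss (hA : RawEntryLetters A loc R ρ B) (h0 : A 0 * G₀ = 1)
    (hG : ∀ i j, ‖G₀ i j‖ ≤ BG * Real.exp (-(ρ * tdist1 Nf (loc i) (loc j)))) (hBG : 0 ≤ BG)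
    (hfib : ∀ y : UT Nf, (univ.filter fun k => loc k = y).card ≤ m)
    (hμ : 0 ≤ μ) (h2μ : 2 * μ ≤ ρ) (hC : 0 ≤ C)
    (hrow : ∀ a : UT Nf, ∑ z : UT Nf, Real.exp (-(μ * tdist1 Nf a z)) ≤ C)
    (hR₁ : 0 < R₁) (hR₁R : R₁ ≤ R)
    (hq : 2 * B * R₁ / R * BG * (m * C) * (m * C) ≤ 1 / 2) :
    RawEntryLetters (fun u => (A u)⁻¹) loc R₁ (ρ - μ) (2 * BG) := by
  -- the word letters at rate `ρ − μ` (§1) and the first word `K(u) = V(u)G₀` for the norm bound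
  have hword := rawEntryLetters_G_mul_pow hA hG hBG hfib hμ (by linarith) hC hrow hR₁.le hR₁R
  have hV : RawEntryLetters (fun u => A 0 - A u) loc R₁ ρ (2 * B * R₁ / R) := rawEntryLetters_zero_sub hA hR₁.le hR₁R
  have hG0 : RawEntryLetters (fun _ : E => G₀) loc R₁ ρ BG := rawEntryLetters_const loc R₁ hBG hG
  have hK : RawEntryLetters (fun u => (A 0 - A u) * G₀) loc R₁ (ρ - μ) (2 * B * R₁ / R * BG * (m * C)) :=
    rawEntryLetters_mul hV hG0 (κ := ρ - μ) (μ := μ) (by linarith) (by linarith) (by linarith) hC hfib hrow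
  -- abbreviations for the two small numbers
  have hθ0 : 0 ≤ 2 * B * R₁ / R * BG * (m * C) := hK.B_nonneg
  have hmC : 0 ≤ (m : ℝ) * C := mul_nonneg (Nat.cast_nonneg _) hC
  have hq0 : 0 ≤ 2 * B * R₁ / R * BG * (m * C) * (m * C) := mul_nonneg hθ0 hmC
  have hq1 : 2 * B * R₁ / R * BG * (m * C) * (m * C) < 1 := hq.trans_lt (by norm_num)
  -- print's «the norm of this operator is small»: the sup-of-row-sums norm of `V(u)G₀` is at most `½` on the thin ball (rate `ρ − μ ≥ μ`)
  have hnorm : ∀ u ∈ ball (0 : E) R₁, ‖(A 0 - A u) * G₀‖ ≤ 1 / 2 := by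
    intro u hu
    refine linfty_opNorm_le_of_rowSum _ (by norm_num) fun i => ?_
    calc ∑ j, ‖((A 0 - A u) * G₀) i j‖
        ≤ ∑ j, 2 * B * R₁ / R * BG * (m * C) * Real.exp (-((ρ - μ) * tdist1 Nf (loc i) (loc j))) :=
          sum_le_sum fun j _ => hK.decay u hu i j
      _ ≤ ∑ j, 2 * B * R₁ / R * BG * (m * C) * Real.exp (-(μ * tdist1 Nf (loc i) (loc j))) := by
          refine sum_le_sum fun j _ => mul_le_mul_of_nonneg_left (Real.exp_le_exp.2 ?_) hθ0
          exact neg_le_neg (mul_le_mul_of_nonneg_right (by linarith) (tdist1_nonneg _ _))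
      _ ≤ 2 * B * R₁ / R * BG * (m * C) * (m * C) := rowSum_decay_le hθ0 hfib hrow i
      _ ≤ 1 / 2 := hq
  have hlt : ∀ u ∈ ball (0 : E) R₁, ‖(A 0 - A u) * G₀‖ < 1 := fun u hu => (hnorm u hu).trans_lt (by norm_num)
  -- (3.86): `A(u)·(G₀ Σₙ (V(u)G₀)ⁿ) = 1`, so `A(u)⁻¹` IS the series
  have hright : ∀ u ∈ ball (0 : E) R₁, A u * gNew G₀ (A 0 - A u) = 1 := by
    intro u hu
    have h := sub_mul_gNew (A 0) (A 0 - A u) G₀ h0 (hlt u hu)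
    rwa [sub_sub_cancel] at h
  have hinv : ∀ u ∈ ball (0 : E) R₁, (A u)⁻¹ = gNew G₀ (A 0 - A u) := fun u hu => Matrix.inv_eq_right_inv (hright u hu)
  refine ⟨fun u hu i j => ?_, fun i j => ?_, by positivity⟩
  · -- the entrywise geometric resummation at rate `ρ − μ`
    have hs := hasSum_apply_of_hasSum (hasSum_gNew G₀ (A 0 - A u) (hlt u hu)) i j
    have hterm : ∀ n : ℕ, ‖(G₀ * ((A 0 - A u) * G₀) ^ n) i j‖ ≤
        BG * (2 * B * R₁ / R * BG * (m * C) * (m * C)) ^ n * Real.exp (-((ρ - μ) * tdist1 Nf (loc i) (loc j))) :=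
      fun n => (hword n).decay u hu i j
    have hgeo : HasSum (fun n : ℕ => BG * (2 * B * R₁ / R * BG * (m * C) * (m * C)) ^ n *
        Real.exp (-((ρ - μ) * tdist1 Nf (loc i) (loc j))))
        (BG * (1 - 2 * B * R₁ / R * BG * (m * C) * (m * C))⁻¹ * Real.exp (-((ρ - μ) * tdist1 Nf (loc i) (loc j)))) :=
      ((hasSum_geometric_of_lt_one hq0 hq1).mul_left BG).mul_right _
    have hbound := HasSum.norm_le_of_bounded hs hgeo hterm
    rw [hinv u hu]
    refine hbound.trans (mul_le_mul_of_nonneg_right ?_ (Real.exp_nonneg _))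
    have hinv2 : (1 - 2 * B * R₁ / R * BG * (m * C) * (m * C))⁻¹ ≤ 2 := by
      rw [inv_le_comm₀ (by linarith) (by norm_num)]
      linarith
    calc BG * (1 - 2 * B * R₁ / R * BG * (m * C) * (m * C))⁻¹ ≤ BG * 2 := mul_le_mul_of_nonneg_left hinv2 hBG
      _ = 2 * BG := by ring
  · -- holomorphy by Cramer: `det A(u)` is a unit on the thin ball (right inverse)
    exact differentiableOn_inv_apply (fun i j => (hA.holo i j).mono (ball_subset_ball hR₁R))
      (fun u hu => Matrix.isUnit_det_of_right_inverse (hright u hu)) i j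

/-- **The same with the torus row sum DISCHARGED for every torus size** (`rowSum_torus`: `C = c₀(1,μ)^ν`, `μ > 0`), `2μ ≤ ρ`, rate `ρ − μ`.
[cite: Balaban1984PropagatorsII, Lemma 2.1 (2.61) p.234; Balaban1985BackgroundPropagators, (3.62)-(3.64) p.402, (3.86) p.407, Thm 3.10 (3.108) p.416] -/
theorem rawEntryLetters_inv_of_neumann_oneLoss_torus (hA : RawEntryLetters A loc R ρ B) (h0 : A 0 * G₀ = 1)
    (hG : ∀ i j, ‖G₀ i j‖ ≤ BG * Real.exp (-(ρ * tdist1 Nf (loc i) (loc j)))) (hBG : 0 ≤ BG)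
    (hfib : ∀ y : UT Nf, (univ.filter fun k => loc k = y).card ≤ m)
    (hμ : 0 < μ) (h2μ : 2 * μ ≤ ρ) (hR₁ : 0 < R₁) (hR₁R : R₁ ≤ R)
    (hq : 2 * B * R₁ / R * BG * (m * B6.c0 1 μ ^ ν) * (m * B6.c0 1 μ ^ ν) ≤ 1 / 2) :
    RawEntryLetters (fun u => (A u)⁻¹) loc R₁ (ρ - μ) (2 * BG) :=
  rawEntryLetters_inv_of_neumann_oneLoss hA h0 hG hBG hfib hμ.le h2μ (pow_nonneg (B6RandomWalk.c0_nonneg 1 μ) ν)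
    (fun a => rowSum_torus Nf hμ a) hR₁ hR₁R hq

/-- The rate-`(ρ − μ)` letters IMPLY module 58's rate-`(ρ − 3μ)` letters (sanity: this file refines 58 §3, `μ ≥ 0`).
[cite: Balaban1985BackgroundPropagators, (3.108) p.416] -/
theorem rawEntryLetters_inv_threeLoss_of_oneLoss {R₁ : ℝ} (hμ : 0 ≤ μ)
    (h : RawEntryLetters (fun u => (A u)⁻¹) loc R₁ (ρ - μ) (2 * BG)) :
    RawEntryLetters (fun u => (A u)⁻¹) loc R₁ (ρ - 3 * μ) (2 * BG) :=
  rawEntryLetters_mono h le_rfl (by linarith) le_rfl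

end Neumann

/-! ## §3. NON-VACUITY (A2 ∕ A6): module 58 §4's toy family at one loss -/

section Toy

/-- ★ **§2 FIRES ON A `u`-DEPENDENT FAMILY** (A2 ∕ A6 witness of `rawEntryLetters_inv_of_neumann_oneLoss_torus`): 58 §4's toy `(γ+u)·1` on
`E = ℂ`, `γ > 0`, any location map, any `μ > 0`: with `R = γ` (letters `(γ, 4μ, 2γ)`), `G₀ = γ⁻¹·1`, the SAME located thin radius
`R₁ = γ∕(8((|p|·c₀(1,μ)^ν)² + 1))` the inverse family has letters `(R₁, 4μ − μ, 2γ⁻¹)` — rate `3μ` where 58 §4 reaches `μ`.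
[folklore] [cite: Balaban1988RG2Cluster, (2.7) p.13 (toy model, not the paper's operator); Balaban1985BackgroundPropagators, (3.86) p.407] -/
theorem rawEntryLetters_inv_of_neumann_oneLoss_toy {γ μ : ℝ} (hγ : 0 < γ) (hμ : 0 < μ) (loc : p → UT Nf) :
    RawEntryLetters (fun u => (toyFamily (p := p) γ u)⁻¹) loc
      (γ / (8 * (((Fintype.card p : ℝ) * B6.c0 1 μ ^ ν) ^ 2 + 1))) (4 * μ - μ) (2 * γ⁻¹) := by
  set S : ℝ := (Fintype.card p : ℝ) * B6.c0 1 μ ^ ν with hS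
  have hS0 : 0 ≤ S := mul_nonneg (Nat.cast_nonneg _) (pow_nonneg (B6RandomWalk.c0_nonneg 1 μ) ν)
  have hden : 0 < 8 * (S ^ 2 + 1) := by positivity
  have hR₁ : 0 < γ / (8 * (S ^ 2 + 1)) := div_pos hγ hden
  have hR₁R : γ / (8 * (S ^ 2 + 1)) ≤ γ := by
    rw [div_le_iff₀ hden]
    nlinarith [sq_nonneg S]
  have hfib : ∀ y : UT Nf, (univ.filter fun k => loc k = y).card ≤ Fintype.card p :=
    fun y => (card_le_univ _)
  refine rawEntryLetters_inv_of_neumann_oneLoss_torus (R := γ) (ρ := 4 * μ) (B := γ + γ) (BG := γ⁻¹) (m := Fintype.card p)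
    (rawEntryLetters_toyFamily hγ.le hγ.le loc (4 * μ)) (toy_rightInverse hγ.ne') (toy_G₀_letters hγ loc (4 * μ))
    (inv_nonneg.2 hγ.le) hfib hμ (by linarith) hR₁ hR₁R ?_
  -- the smallness: `2(2γ)R₁∕γ · γ⁻¹ · S · S = S²∕(2(S²+1)) ≤ ½`
  have e : 2 * (γ + γ) * (γ / (8 * (S ^ 2 + 1))) / γ * γ⁻¹ * S * S = S ^ 2 / (2 * (S ^ 2 + 1)) := by
    field_simp
    ring
  rw [← hS, e, div_le_div_iff₀ (by positivity) (by norm_num)]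
  nlinarith [sq_nonneg S]

end Toy

end Literature.MathematicalPhysics.QuantumFieldTheory.Balaban1983to89.B13InverseLettersNeumannOneLoss

end
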